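import Literature.NumberTheory.Automorphic.Liu2021.AppendixC.HeckeEndomorphism
import HarnessLib

/-!
# [Liu 2021, §4.2 l. 2074 / p. 133 (D.3)] the Hecke endomorphism `[KgK] ∈ End⁰(A_K)` AS A PUSH–PULL: `[KgK] = [K:N]⁻¹ · (t ≫ Σ_{γK ⊆ KgK} Alb T_γ)`

Topic `NumberTheory/Automorphic/Liu2021/AppendixC`; namespace `Literature.NumberTheory.Automorphic.Liu2021.AppendixC.Sec42Data.HeckeTranslates`.
PROOF FILE (five theorems, one private; no definition, no named fact, no instance, no `sorry`).  Sequel of ★ `HeckeEndomorphism` (d6 DEF DH1).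

★ `heckeEnd T hD K g : End⁰(A_K)` is DEFINED through a CHOSEN witness `(m, ψ_g)` of row (D) `T.IsogenyDescent` and characterised `ℓ`-adically
(★ `eq_heckeEnd`: THE element of `End⁰(A_K)` whose `ᵗV_ℓ^ℚ` acts as `[KgK]` on `H¹_ét(A_∞)`).  This file gives its CHOICE-FREE GEOMETRIC
DESCRIPTION at finite level — the classical «pull back along `X_N → X_K`, push forward along the translates `T_γ : X_N → X_K`,
`γK ⊆ KgK`, divide by the degree» ([Bump1997] §4.2 Prop. 4.2.3; [Milne2005ShimuraVarieties] §5 p. 58: Hecke correspondences as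
push–pull through a common finite étale cover):

* `toTower_dualMap_trace` — if `t : A_K ⟶ A_N` is an Albanese TRACE of the level cover `u^N_K : X_N → X_K`, i.e.
  `Alb_u ≫ t = Σ_i Alb(T_{δ_i})` for a finite family `δ_i ∈ K` (the shape ★ `Albanese.exists_trace_of_isSepQuotient_complex` /
  `AlbaneseTraceOfFiniteQuotient` produce, [Lang1983AbelianVarieties] VIII §6), then on the tower `[ᵗV_ℓ(t) θ]_K = Σ_i δ_i · [θ]_N`;
* `toTower_dualMap_sum_albTr` — for a transversal `s` of `KgK/K` with a common admissible source level `N`,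
  `[ᵗV_ℓ(Σ_{γ ∈ s} Alb T_γ) φ]_N = [KgK] [φ]_K`;
* **`heckeEnd_eq_pushPull`** — `heckeEnd T hD K g = (card ι)⁻¹ · (1 ⊗ (t ≫ Σ_{γ ∈ s} Alb(T_γ : X_N → X_K)))` in `End⁰(A_K) = ℚ ⊗ End A_K`
  (granted injective étale pull-backs `hI`, ★ `Sec42Data.toTower_injective`, as every use of `eq_heckeEnd`).  Only `δ_i ∈ K` and
  `ι ≠ ∅` are used from the trace shape (for the genuine trace `ι = K/N` and `card ι = [K : N]`);
* `heckeEnd_eq_pushPull_of_aut` — the same with the trace indexed by automorphisms `act δ ∈ {T_k : k ∈ K}` of `X_N` and `Alb_u` spelled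
  `Albanese.map` (the literal shape of ★ `AlbaneseTraceOfFiniteQuotient` / the (F-P2) Jacobian fact: `Alb_p ≫ t = Σ_δ Alb(act δ)`).

Cell `hodgecm-mathlib` (D-0151), crux `HLiu418` = stmt-HodgeConjecture-24832, d6 line, road (P) leg (P3) (A-plan2 (g12) s211 hand table
2026-08-30 «∃-free head `heckeEnd_eq_pushPull`, optional»; A-p07 (g12) census `CENSUS-RoadP-P2P3-currency` §1).  COUNT-NEUTRAL capital:
HC_CM is proved only modulo the 7 printed citations until rung 0 closes; this file discharges none of them.

## References
* [Liu2021] Y. Liu, *Fourier–Jacobi cycles and arithmetic relative trace formula*, Camb. J. Math. 9 (2021): §4.2 (FJcycle.tex l. 2070–2081,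
  esp. l. 2074 «the homomorphism `𝔾(𝔸_F^∞) → Aut_E(A_∞)` provided by the Hecke correspondences»), p. 133 (before (D.3)).
* [Bump1997] D. Bump, *Automorphic Forms and Representations* (1997), §4.2 Prop. 4.2.3 (`[KgK]` as a sum over `KgK/K`).
* [Milne2005ShimuraVarieties] J. S. Milne, *Introduction to Shimura varieties* (2005), §5 p. 57–58 (Hecke correspondences through `Sh_{K ∩ gKg⁻¹}`).
* [Lang1983AbelianVarieties] S. Lang, *Abelian Varieties* (1983), Ch. VIII §6 (the trace on Albanese varieties).
* [MumfordAV1970] D. Mumford, *Abelian Varieties* (1970), §19 Thm. 3 (`End A → End T_ℓ A` injective).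
-/

set_option autoImplicit false

noncomputable section

open CategoryTheory NumberField Function MulAction
open scoped TensorProduct

namespace Literature.NumberTheory.Automorphic.Liu2021.AppendixC

open Literature.AlgebraicGeometry.Motives (AbelianVariety)
open Literature.AlgebraicGeometry.Motives.AbelianVariety (rationalTateModuleMap rationalTateModuleMap_comp rationalTateModuleMap_add
  endAlgebra rationalTateAction rationalTateAction_of rationalTateAction_algebraMap)

/-! ## §0 Bookkeeping: `ᵗV_ℓ` of a finite sum of homomorphisms -/

/-- `ᵗV_ℓ(Σ_{i ∈ s} f_i) φ = Σ_{i ∈ s} ᵗV_ℓ(f_i) φ` (additivity of `V_ℓ`, ★ `rationalTateModuleMap_add`, dualised; companion of ★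
`dualMap_rationalTateModuleMap_comp_apply`; `T_ℓ`/`V_ℓ` is an additive functor, [MumfordAV1970] §19). [cite: MumfordAV1970, §19 Thm. 3 (and the additivity of `T_ℓ`, p. 176–178)] -/
theorem dualMap_rationalTateModuleMap_sum_apply {K : Type} [Field K] {X Y : AbelianVariety K} (ℓ : ℕ) [Fact ℓ.Prime]
    {ι : Type*} (s : Finset ι) (f : ι → (X ⟶ Y)) (φ : Module.Dual ℚ_[ℓ] (Y.rationalTateModule ℓ)) :
    (rationalTateModuleMap ℓ (∑ i ∈ s, f i)).dualMap φ = ∑ i ∈ s, (rationalTateModuleMap ℓ (f i)).dualMap φ := by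
  classical
  let Vh : (X ⟶ Y) →+ (X.rationalTateModule ℓ →ₗ[ℚ_[ℓ]] Y.rationalTateModule ℓ) :=
    AddMonoidHom.mk' (fun f => rationalTateModuleMap ℓ f) (rationalTateModuleMap_add ℓ)
  have e1 : rationalTateModuleMap ℓ (∑ i ∈ s, f i) = ∑ i ∈ s, rationalTateModuleMap ℓ (f i) := by
    show Vh (∑ i ∈ s, f i) = ∑ i ∈ s, Vh (f i)
    exact map_sum Vh f s
  apply LinearMap.ext
  intro v
  rw [LinearMap.dualMap_apply, e1, LinearMap.sum_apply, map_sum, LinearMap.sum_apply]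
  exact Finset.sum_congr rfl fun i _ => (LinearMap.dualMap_apply _ _ _).symm

/-- the dual of a scalar multiple (pointwise bookkeeping). [folklore] -/
private theorem dualMap_smul_apply' (ℓ : ℕ) [Fact ℓ.Prime] {V W : Type*} [AddCommGroup V] [Module ℚ_[ℓ] V] [AddCommGroup W]
    [Module ℚ_[ℓ] W] (c : ℚ_[ℓ]) (f : V →ₗ[ℚ_[ℓ]] W) (φ : Module.Dual ℚ_[ℓ] W) : (c • f).dualMap φ = c • f.dualMap φ := by
  ext v
  simp only [LinearMap.dualMap_apply, LinearMap.smul_apply, map_smul, smul_eq_mul]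

variable {F E : Type} [Field F] [NumberField F] [IsTotallyReal F] [Field E] [NumberField E] [Algebra F E]
  [IsTotallyComplex E] [Algebra.IsQuadraticExtension F E]
variable {P5 : PropC5Data F E} {isotropicAt : ℕ → Prop}

namespace Sec42Data.HeckeTranslates

variable {C : Sec42Data P5 isotropicAt} (T : C.HeckeTranslates) (ℓ : ℕ) [Fact ℓ.Prime]

/-! ## §1 The trace on the tower: `[ᵗV_ℓ(t) θ]_K = Σ_i δ_i · [θ]_N` -/

/-- **An Albanese trace of the level cover, read on `H¹_ét(A_∞)`**: if `t : A_K ⟶ A_N` satisfies `Alb_{u^N_K} ≫ t = Σ_i Alb(T_{δ_i})`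
for finitely many `δ_i ∈ K` (the trace of the Galois cover `X_N → X_K = X_N/(K/N)`, [Lang1983AbelianVarieties] VIII §6, in the shape
★ `AlbaneseTraceOfFiniteQuotient` / `Albanese.exists_trace_of_isSepQuotient_complex` deliver), then for every level-`N` class `θ`,
`[ᵗV_ℓ(t) θ]_K = Σ_i δ_i · [θ]_N` in `H¹_ét(A_∞)` (`[·]_K ∘ ᵗV_ℓ(Alb_u) = [·]_N`-compatibility ★ `toTower_pull` and the defining formula
★ `etHeckeRep_toTower`). [cite: Liu2021, §4.2 (FJcycle.tex l. 2070–2074 and l. 2158–2160)] [cite: Lang1983AbelianVarieties, Ch. VIII §6 Thm. 13] -/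
theorem toTower_dualMap_trace {N K : C5.SmallLevel C.S.K₀} (h : N ≤ K) (hn : ∀ k ∈ K.1.1, C5.HeckeLE k N N)
    {ι : Type*} (s : Finset ι) (δ : ι → C.G) (hδ : ∀ i, δ i ∈ K.1.1) (t : C.A K ⟶ C.A N)
    (ht : C.Atr (homOfLE h) ≫ t = ∑ i ∈ s, T.albTr (δ i) N N (hn _ (hδ i))) (θ : C.etaleH1 ℓ N) :
    C.toTower ℓ K ((rationalTateModuleMap ℓ t).dualMap θ) = ∑ i ∈ s, T.etHeckeRep ℓ (δ i) (C.toTower ℓ N θ) := by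
  rw [← C.toTower_pull ℓ (homOfLE h) ((rationalTateModuleMap ℓ t).dualMap θ), dualMap_rationalTateModuleMap_comp_apply, ht,
    dualMap_rationalTateModuleMap_sum_apply ℓ, map_sum]
  exact Finset.sum_congr rfl fun i _ => (T.etHeckeRep_toTower ℓ (δ i) (hn _ (hδ i)) θ).symm

/-! ## §2 The push-forward along the cosets of `KgK`, read on the tower: `[ᵗV_ℓ(Σ_γ Alb T_γ) φ]_N = [KgK] [φ]_K` -/

/-- **The sum of the translates `Alb(T_γ) : A_N → A_K` over a transversal `s` of `KgK/K`, read on `H¹_ét(A_∞)`, is the Hecke operator**: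
`[ᵗV_ℓ(Σ_{γ ∈ s} Alb T_γ) φ]_N = [KgK] [φ]_K` (★ `etHeckeRep_toTower` termwise + ★ `heckeOperator_apply_eq_sum` on the `K`-fixed class
`[φ]_K`, for ANY transversal). [cite: Liu2021, §4.2 (FJcycle.tex l. 2074)] [cite: Bump1997, §4.2 (Prop. 4.2.3)] -/
theorem toTower_dualMap_sum_albTr {N K : C5.SmallLevel C.S.K₀} (g : C.G) (s : Finset C.G)
    (hs : Set.BijOn (fun x : C.G => (x : C.G ⧸ (K.1.1 : Subgroup C.G))) s (orbit K.1.1 (g : C.G ⧸ (K.1.1 : Subgroup C.G))))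
    (hsN : ∀ γ ∈ s, C5.HeckeLE γ N K) (φ : C.etaleH1 ℓ K) :
    C.toTower ℓ N ((rationalTateModuleMap ℓ (∑ γ ∈ s.attach, T.albTr (γ : C.G) N K (hsN γ γ.2))).dualMap φ) =
      Literature.NumberTheory.Automorphic.heckeOperator (T.etHeckeRep ℓ) (K.1.1 : Subgroup C.G) g (C.toTower ℓ K φ) := by
  have hfix : C.toTower ℓ K φ ∈ (T.etHeckeRep ℓ).fixedPoints (K.1.1 : Subgroup C.G) :=
    ((T.etHeckeRep ℓ).mem_fixedPoints K.1.1 (C.toTower ℓ K φ)).2 fun _ hk => T.etHeckeRep_toTower_of_mem ℓ hk φ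
  rw [Literature.NumberTheory.Automorphic.heckeOperator_apply_eq_sum (T.etHeckeRep ℓ) (K.1.1 : Subgroup C.G) g s hs hfix,
    dualMap_rationalTateModuleMap_sum_apply ℓ, map_sum, ← Finset.sum_attach s]
  exact Finset.sum_congr rfl fun γ _ => (T.etHeckeRep_toTower ℓ (γ : C.G) (hsN γ γ.2) φ).symm

/-! ## §3 `[KgK]` as a push–pull -/

/-- **`[KgK] = [K:N]⁻¹ · (t ≫ Σ_{γK ⊆ KgK} Alb T_γ)` — the Hecke endomorphism of ★ `heckeEnd` as a push–pull** ([Liu2021] p. 133 «the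
homomorphism `C_c^∞(K\G(𝔸^∞)/K, ℚ) → End(A_K)_ℚ` induced by the Hecke actions»; [Bump1997] Prop. 4.2.3; [Milne2005ShimuraVarieties] §5
p. 58).  Data: a small level `N ≤ K` normalised by `K` (`hn`); an Albanese trace `t : A_K ⟶ A_N` of `u^N_K`, `Alb_u ≫ t = Σ_i Alb(T_{δ_i})`
over a non-empty finite family `δ_i ∈ K` (for the genuine trace, `ι = K/N`); a transversal `s` of `KgK/K` whose members have `N` as an
admissible source level (`γ⁻¹Nγ ⊆ K`, `hsN`; exists by ★ `C5.SmallLevel.exists_normal_le_forall_heckeLE`).  Then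
`heckeEnd T hD K g = (card ι)⁻¹ · (1 ⊗ (t ≫ Σ_{γ ∈ s} Alb T_γ))` in `End⁰(A_K)`.  Proof: by ★ `eq_heckeEnd` it suffices that `ᵗV_ℓ^ℚ` of
the right-hand side acts as `[KgK]` on `H¹_ét(A_∞)`; `ᵗV_ℓ(t ≫ S) = ᵗV_ℓ(t) ∘ ᵗV_ℓ(S)`, §2 turns `ᵗV_ℓ(S) φ` into `[KgK][φ]_K` at level
`N`, §1 turns `ᵗV_ℓ(t)` into `Σ_i δ_i ·` at level `K`, and each `δ_i ∈ K` fixes the `K`-fixed class `[KgK][φ]_K`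
(★ `heckeOperator_apply_mem_fixedPoints`), so the `card ι` copies cancel the scalar.  `hI` (injective étale pull-backs) as in every
use of `eq_heckeEnd`. [cite: Liu2021, p. 133 (before (D.3)) and §4.2 (FJcycle.tex l. 2074)] [cite: Bump1997, §4.2 (Prop. 4.2.3)]
[cite: Milne2005ShimuraVarieties, §5 p. 58 L3–11] [cite: MumfordAV1970, §19 Thm. 3] -/
theorem heckeEnd_eq_pushPull (hD : T.IsogenyDescent)
    (hI : ∀ ⦃K K' : C5.SmallLevel C.S.K₀⦄ (f : K' ⟶ K), Function.Injective (rationalTateModuleMap ℓ (C.Atr f)).dualMap)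
    {N K : C5.SmallLevel C.S.K₀} (h : N ≤ K) (hn : ∀ k ∈ K.1.1, C5.HeckeLE k N N)
    {ι : Type*} [Fintype ι] [Nonempty ι] (δ : ι → C.G) (hδ : ∀ i, δ i ∈ K.1.1) (t : C.A K ⟶ C.A N)
    (ht : C.Atr (homOfLE h) ≫ t = ∑ i, T.albTr (δ i) N N (hn _ (hδ i)))
    (g : C.G) (s : Finset C.G)
    (hs : Set.BijOn (fun x : C.G => (x : C.G ⧸ (K.1.1 : Subgroup C.G))) s (orbit K.1.1 (g : C.G ⧸ (K.1.1 : Subgroup C.G))))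
    (hsN : ∀ γ ∈ s, C5.HeckeLE γ N K) :
    T.heckeEnd hD K g =
      algebraMap ℚ (C.A K).endAlgebra ((Fintype.card ι : ℚ))⁻¹ *
        endAlgebra.of (C.A K) (t ≫ ∑ γ ∈ s.attach, T.albTr (γ : C.G) N K (hsN γ γ.2)) := by
  symm
  refine T.eq_heckeEnd ℓ hD hI K g fun φ => ?_
  have hcard : (Fintype.card ι : ℚ_[ℓ]) ≠ 0 := Nat.cast_ne_zero.2 Fintype.card_ne_zero
  -- the `ℓ`-adic realisation of the right-hand side
  have hV : rationalTateAction (C.A K) ℓ (algebraMap ℚ (C.A K).endAlgebra ((Fintype.card ι : ℚ))⁻¹ *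
        endAlgebra.of (C.A K) (t ≫ ∑ γ ∈ s.attach, T.albTr (γ : C.G) N K (hsN γ γ.2))) =
      ((Fintype.card ι : ℚ_[ℓ]))⁻¹ • rationalTateModuleMap ℓ (t ≫ ∑ γ ∈ s.attach, T.albTr (γ : C.G) N K (hsN γ γ.2)) := by
    rw [map_mul, rationalTateAction_algebraMap, rationalTateAction_of, ← Algebra.smul_def, map_inv₀, map_natCast]
  -- the `K`-fixed class `[KgK][φ]_K`
  have hfix : C.toTower ℓ K φ ∈ (T.etHeckeRep ℓ).fixedPoints (K.1.1 : Subgroup C.G) :=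
    ((T.etHeckeRep ℓ).mem_fixedPoints K.1.1 (C.toTower ℓ K φ)).2 fun _ hk => T.etHeckeRep_toTower_of_mem ℓ hk φ
  have hw : Literature.NumberTheory.Automorphic.heckeOperator (T.etHeckeRep ℓ) (K.1.1 : Subgroup C.G) g (C.toTower ℓ K φ) ∈
      (T.etHeckeRep ℓ).fixedPoints (K.1.1 : Subgroup C.G) :=
    Literature.NumberTheory.Automorphic.heckeOperator_apply_mem_fixedPoints (T.etHeckeRep ℓ) (K.1.1 : Subgroup C.G) g hfix
      (Sec42Data.BettiPinning.finite_orbit_level K g)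
  rw [hV, dualMap_smul_apply' ℓ, map_smul, ← dualMap_rationalTateModuleMap_comp_apply,
    T.toTower_dualMap_trace ℓ h hn Finset.univ δ hδ t ht, T.toTower_dualMap_sum_albTr ℓ g s hs hsN φ]
  have hterm : ∀ i ∈ (Finset.univ : Finset ι),
      T.etHeckeRep ℓ (δ i) (Literature.NumberTheory.Automorphic.heckeOperator (T.etHeckeRep ℓ) (K.1.1 : Subgroup C.G) g (C.toTower ℓ K φ)) =
        Literature.NumberTheory.Automorphic.heckeOperator (T.etHeckeRep ℓ) (K.1.1 : Subgroup C.G) g (C.toTower ℓ K φ) :=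
    fun i _ => ((T.etHeckeRep ℓ).mem_fixedPoints K.1.1 _).1 hw (δ i) (hδ i)
  rw [Finset.sum_congr rfl hterm, Finset.sum_const, Finset.card_univ, ← Nat.cast_smul_eq_nsmul ℚ_[ℓ], smul_smul,
    inv_mul_cancel₀ hcard, one_smul]


/-- **The same, with the trace indexed by the deck group of the level cover** (the shape ★ `AlbaneseTraceOfFiniteQuotient` /
★ `Albanese.exists_trace_of_isSepQuotient_complex` and the (F-P2) Jacobian fact use): `Δ` a non-empty finite index type, `act δ` automorphisms
of `X_N` each of which IS a translate `T_k` (`k ∈ K`) — e.g. the action `k ↦ T_{k⁻¹}` of `K/N` built in ★ `isogenyDescent_of_levelQuotient` —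
and `Alb_{u^N_K} ≫ t = Σ_δ Alb(act δ)` with `Alb_u` spelled `Albanese.map` (★ `Sec42Data.Atr_eq_map`).  Then
`heckeEnd T hD K g = (card Δ)⁻¹ · (1 ⊗ (t ≫ Σ_{γ ∈ s} Alb T_γ))`. [cite: Liu2021, p. 133 (before (D.3)) and §4.2 (FJcycle.tex l. 2074)]
[cite: Lang1983AbelianVarieties, Ch. VIII §6 Thm. 13] [cite: Bump1997, §4.2 (Prop. 4.2.3)] -/
theorem heckeEnd_eq_pushPull_of_aut (hD : T.IsogenyDescent)
    (hI : ∀ ⦃K K' : C5.SmallLevel C.S.K₀⦄ (f : K' ⟶ K), Function.Injective (rationalTateModuleMap ℓ (C.Atr f)).dualMap)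
    {N K : C5.SmallLevel C.S.K₀} (h : N ≤ K) (hn : ∀ k ∈ K.1.1, C5.HeckeLE k N N)
    {Δ : Type*} [Fintype Δ] [Nonempty Δ] (act : Δ → (C.X N ≅ C.X N))
    (hact : ∀ δ, ∃ (k : C.G) (hk : k ∈ K.1.1), (act δ).hom = T.tr k N N (hn k hk)) (t : C.A K ⟶ C.A N)
    (ht : (C.alb N).map (C.alb K) (C.cpt.X.map (homOfLE h)) ≫ t = ∑ δ, (C.alb N).map (C.alb N) (act δ).hom)
    (g : C.G) (s : Finset C.G)
    (hs : Set.BijOn (fun x : C.G => (x : C.G ⧸ (K.1.1 : Subgroup C.G))) s (orbit K.1.1 (g : C.G ⧸ (K.1.1 : Subgroup C.G))))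
    (hsN : ∀ γ ∈ s, C5.HeckeLE γ N K) :
    T.heckeEnd hD K g =
      algebraMap ℚ (C.A K).endAlgebra ((Fintype.card Δ : ℚ))⁻¹ *
        endAlgebra.of (C.A K) (t ≫ ∑ γ ∈ s.attach, T.albTr (γ : C.G) N K (hsN γ γ.2)) := by
  choose k hk hact using hact
  refine T.heckeEnd_eq_pushPull ℓ hD hI h hn k hk t ?_ g s hs hsN
  rw [C.Atr_eq_map (homOfLE h), ht]
  exact Finset.sum_congr rfl fun δ _ => by rw [albTr, ← hact δ]

end Sec42Data.HeckeTranslates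

end Literature.NumberTheory.Automorphic.Liu2021.AppendixC

end
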